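import Literature.Probability.RandomPlanarGeometry.SAWRatioLimit
import Mathlib.Analysis.SpecialFunctions.Pow.Real
import HarnessLib

/-!
# Kesten's ratio rate, lower side with exponent `1/3`, from super-multiplicativity (abstract lemma)

Topic `Literature/Probability/RandomPlanarGeometry` (continues `SAWRatioLimit.lean`: Kesten's iteration lemmas
`Zd.kesten_iter_backward`, `Zd.kesten_prod_le`).

Source: N. Madras, G. Slade, *The Self-Avoiding Walk* (1993), §7.5 Notes, eq. (7.5.2) (Kesten 1963): for fixed
`x ≠ 0`, `-K N^{-1/3} ≤ c_{N+2}(0,x)/c_N(0,x) − μ²` for all large `N` of the parity of `‖x‖₁`.  This file isolates the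
mechanism behind the exponent `1/3` as an ABSTRACT lemma on a positive sequence `a`: Kesten's inequality (7.3.3)
`φ_{n+2} ≥ φ_n − B/n` (`φ_n = a_{n+2}/a_n`), a sub-exponential lower envelope `e^{-c√n} μ^n ≤ a_n`, and a polynomially
lossy super-multiplicativity with a shift, `a_n a_m ≤ (2(n+m)+5)^6 a_{n+m+1}` (odd `n, m ≥ 3`), give
`μ² − a_{N+2}/a_N ≤ K N^{-1/3}` for odd `N ≥ 1`.  (Backward iteration: `a_N ≤ (μ² − u/2)^M a_{N−2M}`; super-multiplicativity at
`(N − 2M, 2M − 1)`: `a_{2M−1} ≤ poly · (μ² − u/2)^M`; the envelope at the SHORT length `2M − 1` gives `M u ≲ √M + log N`, whence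
`u ≲ N^{-1/3}` with `M ≍ uN`.)

## What is here (namespace `Literature.Probability.RandomPlanarGeometry.SAW.Zd.KestenRateLower`)

* `lower_dev_prod` — the backward product bound (first half of the lane's `KestenRate.lower_dev`);
* **`lower_rate_cubeRoot`** — the abstract `1/3`-rate lemma.
-/

noncomputable section

open Filter Topology Finset

namespace Literature.Probability.RandomPlanarGeometry.SAW.Zd

namespace KestenRateLower

/-! ### Backward product bound -/

/-- **Backward product bound** (quantitative Lemma 7.3.1): if `φ_{N'+2M} ≤ μ² − u` and `4MB ≤ u(N'+2M)`, `2M ≤ N'`, then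
backward iteration of (7.3.3) keeps `φ ≤ μ² − u/2` on `[N', N'+2M]`, so `a_{N'+2M} ≤ (μ² − u/2)^M a_{N'}`.
[cite: MadrasSlade1993, Lemma 7.3.1 (proof, quantitative form)] -/
theorem lower_dev_prod {a : ℕ → ℝ} {μ B u : ℝ} (ha : ∀ n, 0 < a n)
    (hB : 0 ≤ B) (hK : ∀ n : ℕ, 1 ≤ n → a (n + 2) / a n - B / n ≤ a (n + 4) / a (n + 2))
    {N' M : ℕ} (hN' : 1 ≤ N') (h2M : 2 * M ≤ N') (hu : 0 < u)
    (hdev : a (N' + 2 * M + 2) / a (N' + 2 * M) ≤ μ ^ 2 - u)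
    (hM : 4 * (M : ℝ) * B ≤ u * ((N' : ℝ) + 2 * M)) :
    a (N' + 2 * M) ≤ (μ ^ 2 - u / 2) ^ M * a N' := by
  have hN0 : (0 : ℝ) < N' := by exact_mod_cast hN'
  set q : ℝ := μ ^ 2 - u / 2 with hq
  have hK' : ∀ n : ℕ, 1 ≤ n → (fun n => a (n + 2) / a n) n - B / n ≤ (fun n => a (n + 2) / a n) (n + 2) := by
    intro n hn; simpa [add_assoc] using hK n hn
  have hiter := kesten_iter_backward (φ := fun n => a (n + 2) / a n) (N₁ := 1) hB hK'
  have hMB : (M : ℝ) * B / N' ≤ u / 2 := by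
    rw [div_le_iff₀ hN0]
    have : (2 : ℝ) * M ≤ N' := by exact_mod_cast h2M
    nlinarith
  have hstep : ∀ j < M, a (N' + 2 * j + 2) / a (N' + 2 * j) ≤ q := by
    intro j hj
    have h1 := hiter (M - j) (N' + 2 * j) (by omega) (by omega)
    have e : N' + 2 * j + 2 * (M - j) = N' + 2 * M := by omega
    rw [e] at h1
    have h2 : ((M - j : ℕ) : ℝ) * B / ((N' + 2 * j : ℕ) : ℝ) ≤ M * B / N' := by
      have hMj : ((M - j : ℕ) : ℝ) ≤ M := by exact_mod_cast Nat.sub_le M j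
      have hden : (N' : ℝ) ≤ ((N' + 2 * j : ℕ) : ℝ) := by exact_mod_cast Nat.le_add_right N' (2 * j)
      calc ((M - j : ℕ) : ℝ) * B / ((N' + 2 * j : ℕ) : ℝ) ≤ M * B / ((N' + 2 * j : ℕ) : ℝ) :=
            div_le_div_of_nonneg_right (mul_le_mul_of_nonneg_right hMj hB) (by positivity)
        _ ≤ M * B / N' := div_le_div_of_nonneg_left (by positivity) hN0 hden
    have e1 : a (N' + 2 * j + 2) / a (N' + 2 * j) = (fun n => a (n + 2) / a n) (N' + 2 * j) := rfl
    have e2 : a (N' + 2 * M + 2) / a (N' + 2 * M) = (fun n => a (n + 2) / a n) (N' + 2 * M) := rfl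
    rw [e1]; rw [e2] at hdev
    simp only [] at h1 hdev ⊢
    linarith
  exact kesten_prod_le ha (n := N') (M := M) hstep

/-! ### Elementary real lemmas -/

/-- `x ≤ K` from `x² ≤ K`, `K ≥ 1`, `x ≥ 0`. [folklore] -/
private theorem le_of_sq_le {x K : ℝ} (hx : 0 ≤ x) (hK : 1 ≤ K) (h : x ^ 2 ≤ K) : x ≤ K := by
  by_contra hc
  push Not at hc
  have : K * K < x * x := mul_lt_mul'' hc hc (by linarith) (by linarith)
  nlinarith

/-- `x ≤ K` from `x³ ≤ K`, `K ≥ 1`, `x ≥ 0`. [folklore] -/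
private theorem le_of_cube_le {x K : ℝ} (hx : 0 ≤ x) (hK : 1 ≤ K) (h : x ^ 3 ≤ K) : x ≤ K := by
  by_contra hc
  push Not at hc
  have h1 : 1 < x := by linarith
  have : K < x ^ 3 := by nlinarith [mul_lt_mul'' hc hc (by linarith) (by linarith)]
  linarith

/-- `log x ≤ 3 x^{1/3}` for `x > 0`. [folklore] -/
private theorem log_le_three_rpow_third {x : ℝ} (hx : 0 < x) : Real.log x ≤ 3 * x ^ ((1 : ℝ) / 3) := by
  have h := Real.log_le_sub_one_of_pos (Real.rpow_pos_of_pos hx ((1 : ℝ) / 3))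
  rw [Real.log_rpow hx] at h
  linarith

/-- The cube root: `t = N^{1/3}` satisfies `t³ = N`, `t ≥ 1` for `N ≥ 1`, and `N^{-1/3} = t⁻¹`. [folklore] -/
private theorem cubeRoot_facts {N : ℝ} (hN : 1 ≤ N) :
    0 < N ^ ((1 : ℝ) / 3) ∧ 1 ≤ N ^ ((1 : ℝ) / 3) ∧ (N ^ ((1 : ℝ) / 3)) ^ 3 = N ∧
      N ^ (-(1 : ℝ) / 3) = (N ^ ((1 : ℝ) / 3))⁻¹ := by
  have hN0 : 0 < N := by linarith
  refine ⟨Real.rpow_pos_of_pos hN0 _, Real.one_le_rpow hN (by norm_num), ?_, ?_⟩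
  · rw [← Real.rpow_natCast, ← Real.rpow_mul hN0.le]; norm_num
  · rw [show (-(1 : ℝ) / 3) = -((1 : ℝ) / 3) by ring, Real.rpow_neg hN0.le]

/-- `(5N)^{1/3} ≤ 2 N^{1/3}`. [folklore] -/
private theorem rpow_third_five_mul_le {N : ℝ} (hN : 0 ≤ N) : (5 * N) ^ ((1 : ℝ) / 3) ≤ 2 * N ^ ((1 : ℝ) / 3) := by
  rw [Real.mul_rpow (by norm_num) hN]
  apply mul_le_mul_of_nonneg_right _ (Real.rpow_nonneg hN _)
  have : (5 : ℝ) ^ ((1 : ℝ) / 3) ≤ (8 : ℝ) ^ ((1 : ℝ) / 3) := Real.rpow_le_rpow (by norm_num) (by norm_num) (by norm_num)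
  refine this.trans (le_of_eq ?_)
  rw [show (8 : ℝ) = 2 ^ (3 : ℕ) by norm_num, ← Real.rpow_natCast, ← Real.rpow_mul (by norm_num)]; norm_num

/-- Algebra: `μ² − u/2 = μ² (1 − u/(2μ²))`. [folklore] -/
private theorem aux_q (μ u : ℝ) (hμ : 0 < μ) : μ ^ 2 - u / 2 = μ ^ 2 * (1 - u / (2 * μ ^ 2)) := by
  field_simp

/-- Algebra. [folklore] -/
private theorem aux_A (u N B μ : ℝ) (hB : 0 < B) (hμ : 0 < μ) :
    u * N / (8 * B) * (u / (2 * μ ^ 2)) = u ^ 2 * N / (16 * B * μ ^ 2) := by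
  field_simp
  ring

/-- Algebra. [folklore] -/
private theorem aux_B (u N B μ : ℝ) (hB : 0 < B) (hμ : 0 < μ) :
    u * N / (8 * B) * (u / (2 * μ ^ 2)) ^ 2 = u ^ 3 * N / (32 * B * μ ^ 4) := by
  field_simp
  ring

/-- Algebra. [folklore] -/
private theorem aux_y (u N B : ℝ) (hB : 0 < B) : u * N / (4 * B) / 2 = u * N / (8 * B) := by
  field_simp
  ring

/-! ### The abstract `1/3`-rate lemma -/

/-- **Lower deviation rate `N^{-1/3}` from super-multiplicativity.** For a positive sequence `a` with Kesten's
inequality (7.3.3) (constant `B ≥ max(1, μ²)`, all `n ≥ 1`), the lower envelope `e^{-c√n} μ^n ≤ a_n`, and the shifted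
super-multiplicativity `a_n a_m ≤ (2(n+m+1)+3)^6 a_{n+m+1}` for odd `n, m ≥ 3`: there is `K` such that for every odd
`N ≥ 1` and `u > 0` with `a_{N+2}/a_N ≤ μ² − u`, `u ≤ K · N^{-1/3}`.
[cite: MadrasSlade1993, §7.5, eq. (7.5.2) (Kesten 1963: the exponent 1/3); Lemma 7.3.1] -/
theorem lower_rate_cubeRoot {a : ℕ → ℝ} {μ B c : ℝ} (ha : ∀ n, 0 < a n) (hμ : 1 ≤ μ)
    (hB1 : 1 ≤ B) (hBμ : μ ^ 2 ≤ B) (hc : 0 ≤ c)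
    (hK : ∀ n : ℕ, 1 ≤ n → a (n + 2) / a n - B / n ≤ a (n + 4) / a (n + 2))
    (hlo : ∀ n : ℕ, Real.exp (-(c * Real.sqrt n)) * μ ^ n ≤ a n)
    (hSM : ∀ n m : ℕ, Odd n → Odd m → 3 ≤ n → 3 ≤ m →
      a n * a m ≤ (2 * ((n : ℝ) + m + 1) + 3) ^ 6 * a (n + m + 1)) :
    ∃ K : ℝ, ∀ N : ℕ, 1 ≤ N → Odd N → ∀ u : ℝ, 0 < u → a (N + 2) / a N ≤ μ ^ 2 - u →
      u ≤ K * (N : ℝ) ^ (-(1 : ℝ) / 3) := by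
  have hμ0 : 0 < μ := by linarith
  have hB0 : 0 < B := by linarith
  have hlogμ : 0 ≤ Real.log μ := Real.log_nonneg hμ
  -- the constants
  set KA : ℝ := 32 * B * μ ^ 2 * (36 + Real.log μ) with hKA
  set KB : ℝ := 256 * B * μ ^ 4 * c ^ 2 with hKB
  set K : ℝ := max (max 1 KA) (max KB (8 * B)) with hKdef
  have hK1 : 1 ≤ K := le_trans (le_max_left _ _) (le_max_left _ _)
  have hKA_le : KA ≤ K := le_trans (le_max_right _ _) (le_max_left _ _)
  have hKB_le : KB ≤ K := le_trans (le_max_left _ _) (le_max_right _ _)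
  have h8B_le : 8 * B ≤ K := le_trans (le_max_right _ _) (le_max_right _ _)
  refine ⟨K, fun N hN hodd u hu hdev => ?_⟩
  have hNr : (1 : ℝ) ≤ N := by exact_mod_cast hN
  have hN0 : (0 : ℝ) < N := by linarith
  obtain ⟨ht0, ht1, ht3, htinv⟩ := cubeRoot_facts hNr
  set t : ℝ := (N : ℝ) ^ ((1 : ℝ) / 3) with htdef
  rw [htinv]
  -- it suffices to bound `u * t ≤ K`
  rw [← div_eq_mul_inv, le_div_iff₀ ht0]
  -- `u < μ²`
  have hφpos : 0 < a (N + 2) / a N := div_pos (ha _) (ha _)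
  have huμ : u < μ ^ 2 := by linarith
  -- the block count `y = uN/(4B)`
  set y : ℝ := u * N / (4 * B) with hy
  have hy0 : 0 ≤ y := by positivity
  by_cases hsmall : y < 2
  · -- few blocks: `u N < 8 B`, so `u t ≤ 8B t / N ≤ 8 B`
    have h1 : u * N < 8 * B := by
      rw [hy, div_lt_iff₀ (by positivity)] at hsmall; linarith
    have h2 : u * t * t ^ 2 ≤ 8 * B := by
      have : u * t * t ^ 2 = u * N := by rw [← ht3]; ring
      rw [this]; exact h1.le
    have ht2 : 1 ≤ t ^ 2 := one_le_pow₀ ht1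
    have : u * t ≤ 8 * B := by
      have hut : 0 ≤ u * t := by positivity
      nlinarith
    exact this.trans h8B_le
  · push Not at hsmall
    -- `M = ⌊y⌋ ≥ 2`, `M ≤ y < M + 1`
    set M : ℕ := ⌊y⌋₊ with hMdef
    have hMle : (M : ℝ) ≤ y := Nat.floor_le hy0
    have hMlt : y < M + 1 := Nat.lt_floor_add_one y
    have hM2 : 2 ≤ M := by
      have : (2 : ℝ) ≤ M := by
        have := Nat.le_floor (show ((2 : ℕ) : ℝ) ≤ y by exact_mod_cast hsmall)
        exact_mod_cast this
      exact_mod_cast this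
    have hMr2 : (2 : ℝ) ≤ M := by exact_mod_cast hM2
    have hMy : y / 2 ≤ M := by linarith
    -- `4 M B ≤ u N` and `4M ≤ N`
    have h4MB : 4 * (M : ℝ) * B ≤ u * N := by
      have := mul_le_mul_of_nonneg_right hMle (show (0 : ℝ) ≤ 4 * B by positivity)
      rw [hy, div_mul_cancel₀ _ (by positivity)] at this
      linarith
    have h4M : 4 * M ≤ N := by
      have : 4 * (M : ℝ) ≤ N := by
        have h1 : 4 * (M : ℝ) * B ≤ B * N := by
          calc 4 * (M : ℝ) * B ≤ u * N := h4MB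
            _ ≤ B * N := mul_le_mul_of_nonneg_right (by linarith) hN0.le
        have h2 : 4 * (M : ℝ) * B ≤ N * B := by linarith
        exact le_of_mul_le_mul_right h2 hB0
      exact_mod_cast this
    -- `N' = N - 2M`, odd, `≥ 3`
    obtain ⟨N', hN'⟩ : ∃ N', N = N' + 2 * M := ⟨N - 2 * M, by omega⟩
    have hN'3 : 3 ≤ N' := by
      obtain ⟨k, hk⟩ := hodd; omega
    have hN'odd : Odd N' := by obtain ⟨k, hk⟩ := hodd; exact ⟨k - M, by omega⟩
    have h2M : 2 * M ≤ N' := by omega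
    -- the product bound
    rw [hN'] at hdev
    have hprod := lower_dev_prod ha (by linarith) hK (by omega) h2M hu hdev (by push_cast [hN'] at h4MB ⊢; linarith)
    set q : ℝ := μ ^ 2 - u / 2 with hq
    have hq0 : 0 < q := by rw [hq]; linarith
    -- super-multiplicativity at `(N', 2M-1)`
    have hm_odd : Odd (2 * M - 1) := ⟨M - 1, by omega⟩
    have hSM' := hSM N' (2 * M - 1) hN'odd hm_odd hN'3 (by omega)
    have eNM : N' + (2 * M - 1) + 1 = N' + 2 * M := by omega
    rw [eNM] at hSM'
    have ecast : (2 * ((N' : ℝ) + ((2 * M - 1 : ℕ) : ℝ) + 1) + 3) = 2 * (N : ℝ) + 3 := by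
      rw [hN']; push_cast [Nat.cast_sub (show 1 ≤ 2 * M by omega)]; ring
    rw [ecast] at hSM'
    set P : ℝ := (2 * (N : ℝ) + 3) ^ 6 with hP
    have hP1 : 1 ≤ P := one_le_pow₀ (by linarith)
    -- `a(2M-1) ≤ P q^M`
    have ham : a (2 * M - 1) ≤ P * q ^ M := by
      have h1 : a N' * a (2 * M - 1) ≤ P * (q ^ M * a N') := hSM'.trans (mul_le_mul_of_nonneg_left hprod (by positivity))
      have h2 : a N' * a (2 * M - 1) ≤ a N' * (P * q ^ M) := by linarith [h1]
      exact le_of_mul_le_mul_left h2 (ha N')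
    -- the envelope at `2M - 1`: `e^{-c√(2M-1)} μ^{2M-1} ≤ P μ^{2M} (1 - u/(2μ²))^M`
    have henv := (hlo (2 * M - 1)).trans ham
    -- logs: `-M log(1 - x) ≤ log P + log μ + c√(2M-1)`, `x = u/(2μ²)`
    set x : ℝ := u / (2 * μ ^ 2) with hx
    have hx0 : 0 < x := by positivity
    have hx1 : x < 1 := by
      rw [hx, div_lt_one (by positivity)]
      have : (0 : ℝ) ≤ μ ^ 2 := sq_nonneg μ
      linarith
    have hqx : q = μ ^ 2 * (1 - x) := by rw [hq, hx]; exact aux_q μ u hμ0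
    have hlog1 : (M : ℝ) * -Real.log (1 - x) ≤ Real.log P + Real.log μ + c * Real.sqrt ((2 * M - 1 : ℕ) : ℝ) := by
      have hpos1 : 0 < Real.exp (-(c * Real.sqrt ((2 * M - 1 : ℕ) : ℝ))) * μ ^ (2 * M - 1) := by positivity
      have h := Real.log_le_log hpos1 henv
      have e : ((2 * M - 1 : ℕ) : ℝ) = 2 * (M : ℝ) - 1 := by
        rw [Nat.cast_sub (show 1 ≤ 2 * M by omega)]; push_cast; ring
      have hL : Real.log (Real.exp (-(c * Real.sqrt ((2 * M - 1 : ℕ) : ℝ))) * μ ^ (2 * M - 1)) =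
          -(c * Real.sqrt ((2 * M - 1 : ℕ) : ℝ)) + (2 * (M : ℝ) - 1) * Real.log μ := by
        rw [Real.log_mul (Real.exp_pos _).ne' (by positivity), Real.log_exp, Real.log_pow, e]
      have hlogq : Real.log q = 2 * Real.log μ + Real.log (1 - x) := by
        rw [hqx, Real.log_mul (by positivity) (by linarith), Real.log_pow]; push_cast; ring
      have hRlog : Real.log (P * q ^ M) = Real.log P + (M : ℝ) * (2 * Real.log μ + Real.log (1 - x)) := by
        rw [Real.log_mul (by positivity) (pow_pos hq0 M).ne', Real.log_pow (n := M), hlogq]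
      rw [hL, hRlog] at h
      linarith [h, hlogμ]
    -- `-log(1-x) ≥ x`, `√(2M-1) ≤ √2 √M`
    have hlog2 : x ≤ -Real.log (1 - x) := by
      have := Real.log_le_sub_one_of_pos (show 0 < 1 - x by linarith); linarith
    have hsq : Real.sqrt ((2 * M - 1 : ℕ) : ℝ) ≤ Real.sqrt 2 * Real.sqrt M := by
      rw [← Real.sqrt_mul (by norm_num)]
      exact Real.sqrt_le_sqrt (by rw [Nat.cast_sub (show 1 ≤ 2 * M by omega)]; push_cast; linarith)
    have hlogP : Real.log P ≤ 6 * Real.log (2 * (N : ℝ) + 3) := by rw [hP, Real.log_pow]; push_cast; exact le_rfl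
    set R : ℝ := 6 * Real.log (2 * (N : ℝ) + 3) + Real.log μ with hR
    have hR0 : 0 ≤ R := by
      have : 0 ≤ Real.log (2 * (N : ℝ) + 3) := Real.log_nonneg (by linarith); positivity
    have hmain : (M : ℝ) * x ≤ R + c * Real.sqrt 2 * Real.sqrt M := by
      have h1 : (M : ℝ) * x ≤ (M : ℝ) * -Real.log (1 - x) := mul_le_mul_of_nonneg_left hlog2 (by positivity)
      have h2 : c * Real.sqrt ((2 * M - 1 : ℕ) : ℝ) ≤ c * (Real.sqrt 2 * Real.sqrt M) := mul_le_mul_of_nonneg_left hsq hc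
      linarith
    -- `R ≤ (36 + log μ) t`
    have hRt : R ≤ (36 + Real.log μ) * t := by
      have h1 : Real.log (2 * (N : ℝ) + 3) ≤ 3 * (2 * (N : ℝ) + 3) ^ ((1 : ℝ) / 3) := log_le_three_rpow_third (by linarith)
      have h2 : (2 * (N : ℝ) + 3) ^ ((1 : ℝ) / 3) ≤ (5 * (N : ℝ)) ^ ((1 : ℝ) / 3) :=
        Real.rpow_le_rpow (by linarith) (by linarith) (by norm_num)
      have h3 := rpow_third_five_mul_le hN0.le
      have hLt : Real.log (2 * (N : ℝ) + 3) ≤ 6 * t := by rw [htdef]; linarith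
      have h4 : Real.log μ ≤ Real.log μ * t := le_mul_of_one_le_right hlogμ ht1
      rw [hR]; linarith
    have hMy' : u * N / (8 * B) ≤ M := by
      have : y / 2 = u * N / (8 * B) := by rw [hy]; exact aux_y u N B hB0
      linarith
    -- case split on the dominant term
    have hut0 : 0 ≤ u * t := by positivity
    rcases le_or_gt ((M : ℝ) * x / 2) R with hA | hB'
    · -- (A): `M x ≤ 2R` ⇒ `u² N ≤ 32 B μ² R ≤ KA · t`, so `(ut)² ≤ KA`
      have h1 : (M : ℝ) * x ≤ 2 * R := by linarith
      have h2 : u * N / (8 * B) * x ≤ 2 * R := le_trans (mul_le_mul_of_nonneg_right hMy' hx0.le) h1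
      have h3 : u ^ 2 * N ≤ 32 * B * μ ^ 2 * R := by
        rw [hx, aux_A u N B μ hB0 hμ0, div_le_iff₀ (by positivity)] at h2
        linarith
      have h4 : u ^ 2 * N ≤ KA * t := by
        rw [hKA]
        calc u ^ 2 * N ≤ 32 * B * μ ^ 2 * R := h3
          _ ≤ 32 * B * μ ^ 2 * ((36 + Real.log μ) * t) := mul_le_mul_of_nonneg_left hRt (by positivity)
          _ = 32 * B * μ ^ 2 * (36 + Real.log μ) * t := by ring
      have h5 : (u * t) ^ 2 ≤ KA := by
        have e : u ^ 2 * N = (u * t) ^ 2 * t := by rw [← ht3]; ring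
        rw [e] at h4
        exact le_of_mul_le_mul_right h4 ht0
      have hKA1 : 1 ≤ max 1 KA := le_max_left _ _
      exact (le_of_sq_le hut0 hKA1 (h5.trans (le_max_right _ _))).trans (le_max_left _ _)
    · -- (B): `M x/2 ≤ c√2 √M` ⇒ `M x² ≤ 8 c²` ⇒ `u³ N ≤ 256 B μ⁴ c²`, so `(ut)³ ≤ KB`
      have h1 : (M : ℝ) * x / 2 ≤ c * Real.sqrt 2 * Real.sqrt M := by linarith
      have hM0 : (0 : ℝ) < M := by linarith
      have hsM : Real.sqrt (M : ℝ) ^ 2 = M := Real.sq_sqrt hM0.le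
      have hs2 : Real.sqrt (2 : ℝ) ^ 2 = 2 := Real.sq_sqrt (by norm_num)
      have h2 : (M : ℝ) * x ^ 2 ≤ 8 * c ^ 2 := by
        -- square `M x ≤ 2 c √2 √M` (both sides ≥ 0)
        have hl : 0 ≤ (M : ℝ) * x := by positivity
        have h3 : ((M : ℝ) * x) ^ 2 ≤ (2 * c * Real.sqrt 2 * Real.sqrt M) ^ 2 :=
          pow_le_pow_left₀ hl (by linarith) 2
        have e : (2 * c * Real.sqrt 2 * Real.sqrt (M : ℝ)) ^ 2 = 8 * c ^ 2 * M := by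
          have : (2 * c * Real.sqrt 2 * Real.sqrt (M : ℝ)) ^ 2 = 4 * c ^ 2 * Real.sqrt 2 ^ 2 * Real.sqrt (M : ℝ) ^ 2 := by ring
          rw [this, hs2, hsM]; ring
        rw [e] at h3
        have e2 : ((M : ℝ) * x) ^ 2 = (M : ℝ) * ((M : ℝ) * x ^ 2) := by ring
        rw [e2] at h3
        have h4 : (M : ℝ) * ((M : ℝ) * x ^ 2) ≤ (M : ℝ) * (8 * c ^ 2) := by linarith
        exact le_of_mul_le_mul_left h4 hM0
      have h3 : u ^ 3 * N ≤ KB := by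
        have h4 : u * N / (8 * B) * x ^ 2 ≤ 8 * c ^ 2 :=
          le_trans (mul_le_mul_of_nonneg_right hMy' (by positivity)) h2
        rw [hx, aux_B u N B μ hB0 hμ0, div_le_iff₀ (by positivity)] at h4
        rw [hKB]; linarith
      have h5 : (u * t) ^ 3 ≤ KB := by
        have e : u ^ 3 * N = (u * t) ^ 3 := by rw [← ht3]; ring
        rw [e] at h3; exact h3
      have hKB1 : 1 ≤ max 1 KB := le_max_left _ _
      have := le_of_cube_le hut0 hKB1 (h5.trans (le_max_right _ _))
      exact this.trans (max_le hK1 hKB_le)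

end KestenRateLower

end Literature.Probability.RandomPlanarGeometry.SAW.Zd
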